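import Mathlib
import Summits.QuantumAdvantage.AdviceFreeQNC0.RingHardOdd

set_option linter.dupNamespace false
set_option linter.style.longLine false

/-!
# Universal-hard inputs for window strategies with global advice — the light-cone rung, uniformly in the radius
(cell decomp-qadv, lens 1 «grading / quantitative ladder», g13; node `RateDial` on ScaleDial:26910, instrument «light cone»;
memo `run/shared/lean/pub/decomp-qadv/decomp-qadv-lens-1/g13/lightcone/LIGHTCONE.md` §4e)

For the mod-3 ring-HLF relation `RingHLF.Rel` on the odd class (`OddZeros`), a ROTATION-COVARIANT WINDOW STRATEGY of radius
`r` answers `z_i = F(x_{i−r}, …, x_{i+r}, a(x))` where `a` is any GLOBAL advice (here `|x| mod 3`; the proof handles every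
advice at once).  **Theorem (`windowSymHard3All`, `universalHard_all`).**  For every `r` and every `n ≥ 6r+9` there is an
explicit input `x ∈ {0,1}ⁿ` of the odd class — ones at `{0, 2r+1, 4r+4}` (`n` even) resp. `{0, 1, 2r+2, 2r+3, 4r+6, 4r+7}`
(`n` odd) — on which EVERY radius-`r` window strategy with EVERY global advice violates the relation (`UniversalHard r x`).
Proof (the pairing engine `not_rel_window_of_pairing`): the kernel vector `v` of `x` (`InKernel x v`) has sign bit
`signBit x v = 1`, while the radius-`r` windows of `x` over the support of `v` are matched by an explicit fixed-point-free
involution `σ` preserving the window; so `Σ_{b ∈ supp v} z_b` is even for every window strategy, contradicting `Rel`.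
Support, sign and `σ` are closed forms with 12 (even `n`) resp. 24 (odd `n`) pairwise-disjoint linear branches, verified by
`omega` (two declarations need `maxHeartbeats` 4·10⁶ / 8·10⁶).

RELATION TO THE TREE.  `WindowLocalHard.windowLocalHardU` and `RingWindowLocalLt3Proof.ringWindowLocalLt3` bound the NUMBER of
inputs an advice-FREE window-local strategy (polylog radius) wins by `θ·2ⁿ`, one `θ < 1`; they do not give a losing input for
strategies with 3-valued global advice (a union bound would need `θ < 1/3`), let alone one input losing for ALL `F`
simultaneously.  Conversely this file is constant-radius and says nothing about densities.  Both are implied by the summit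
conjecture `AdviceFreeQNC0Three` (constant degree); neither moves `MesoHi3`.  Value for route ScaleDial / node RateDial: a
BC5-grade witness bank for every window rung at once, and the certificate technology (closed-form support + sign + pairing)
the first open rung `QuadraticQRung3` (unbounded light cone) must defeat.

Main declarations: `window`, `count3`, `windowStrat`, `WindowSymHard3`, `WindowSymHard3All`, `UniversalHard`,
`universalHard_of_pairing`, `window_apply`, `xU_universalHard`, `xUO_universalHard`, `universalHard_all`,
`windowSymHard3All`, `windowSymHard3_all_explicit`, `windowHard_any_advice` (any advice of any type).  No `sorry`, no `native_decide`; axioms `propext`, `Classical.choice`,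
`Quot.sound`.
-/

namespace Summit.QuantumAdvantage.AdviceFreeQNC0.LightConeWindowHard

open Finset Summit.QuantumAdvantage.AdviceFreeQNC0
open Literature.Computability.QuantumComplexity Literature.Computability.QuantumComplexity.RingHLF

/-- The cyclic window of radius `r` around position `i`: entry `d : Fin (2r+1)` is `x (i - r + d)` (indices mod `n`). -/
def window {n : ℕ} (r : ℕ) (x : Fin n → Bool) (i : Fin n) : Fin (2 * r + 1) → Bool :=
  fun d => x ⟨((i : ℕ) + n * r + n - r + d) % n, Nat.mod_lt _ (Fin.pos i)⟩

/-- Hamming weight of the input mod 3 — the symmetric (rotation-invariant, degree-2-computable) advice. -/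
def count3 {n : ℕ} (x : Fin n → Bool) : ZMod 3 := ((univ.filter fun j : Fin n => x j = true).card : ZMod 3)

/-- The rotation-covariant strategy defined by a window table `F` with mod-3 advice. -/
def windowStrat {n : ℕ} (r : ℕ) (F : (Fin (2 * r + 1) → Bool) → ZMod 3 → Bool) (x : Fin n → Bool) : Fin n → Bool :=
  fun i => F (window r x i) (count3 x)

/-- RUNG (ATTACKABLE; data: true with `n₀ = 2r + 5`?? — measured thresholds `n₀(1) = 7`, `n₀(2) = 10`, `n₀(3) = 12`,
`n₀(4) = 14`, i.e. `n₀(r) = 2r + 5` for `r ≥ 2`): for every window radius `r`, eventually no window strategy with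
mod-3 advice is perfect on the odd class. -/
def WindowSymHard3 (r : ℕ) : Prop :=
  ∃ n₀ : ℕ, ∀ n ≥ n₀, ∀ F : (Fin (2 * r + 1) → Bool) → ZMod 3 → Bool,
    ∃ x : Fin n → Bool, OddZeros x ∧ ¬ RingHLF.Rel x (windowStrat r F x)

/-- The uniform version over all radii (still T-implied: each instance has constant degree). -/
def WindowSymHard3All : Prop := ∀ r : ℕ, WindowSymHard3 r

/-- UNIVERSAL HARD INPUT property (the proof schema): an odd-class input on which EVERY radius-`r` window strategy with
ANY rotation-invariant advice loses — because its windows over the kernel support pair up while the sign bit is 1.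
Stated extensionally (advice is constant along the input, so it is absorbed into `F`). -/
def UniversalHard (r : ℕ) {n : ℕ} (x : Fin n → Bool) : Prop :=
  OddZeros x ∧ ∀ F : (Fin (2 * r + 1) → Bool) → Bool, ¬ RingHLF.Rel x (fun i => F (window r x i))

/-- How the schema feeds the rung: universal-hard inputs for all large `n` give `WindowSymHard3 r` with the same `n₀`
(three residue families per radius). -/
def SchemaClosesRung (r : ℕ) : Prop :=
  (∃ n₀ : ℕ, ∀ n ≥ n₀, ∃ x : Fin n → Bool, UniversalHard r x) → WindowSymHard3 r

/-- LightConeWindowHardA helper `schemaClosesRung` (decomp-qadv land package; see the module docstring). -/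
theorem schemaClosesRung (r : ℕ) : SchemaClosesRung r := by
  rintro ⟨n₀, h⟩
  refine ⟨n₀, fun n hn F => ?_⟩
  obtain ⟨x, hodd, hx⟩ := h n hn
  exact ⟨x, hodd, hx (fun w => F w (count3 x))⟩

/-! ## The pairing engine (PROVED) and the first certified universal-hard input (n = 12) -/

/-- PAIRING LEMMA: if a fixed-point-free involution `σ` of `supp v` preserves `z`, then `⟨v, z⟩ ≡ 0 (mod 2)`. -/
theorem dot2_eq_zero_of_pairing {n : ℕ} (v z : Fin n → Bool) (σ : Fin n → Fin n)
    (hσv : ∀ b, v b = true → v (σ b) = true) (hσz : ∀ b, v b = true → z (σ b) = z b)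
    (hfix : ∀ b, v b = true → σ b ≠ b) (hinv : ∀ b, v b = true → σ (σ b) = b) :
    dot2 v z = 0 := by
  unfold dot2
  set s : Finset (Fin n) := univ.filter (fun b : Fin n => v b = true ∧ z b = true) with hs
  have hmem : ∀ b, b ∈ s ↔ (v b = true ∧ z b = true) := fun b => by simp [hs]
  have hsum : ∑ b ∈ s, (1 : ZMod 2) = 0 := by
    refine Finset.sum_involution (fun b _ => σ b) ?_ ?_ ?_ ?_
    · intro b _; decide
    · intro b hb _; exact hfix b ((hmem b).1 hb).1
    · intro b hb
      obtain ⟨hv, hz⟩ := (hmem b).1 hb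
      exact (hmem _).2 ⟨hσv b hv, by rw [hσz b hv]; exact hz⟩
    · intro b hb; exact hinv b ((hmem b).1 hb).1
  have hcast : ((s.card : ℕ) : ZMod 2) = 0 := by
    rw [Finset.card_eq_sum_ones, Nat.cast_sum]; simpa using hsum
  have h2 : 2 ∣ s.card := (ZMod.natCast_eq_zero_iff _ _).1 hcast
  omega

/-- UNIVERSAL LOSS from a certificate: a kernel vector `v` with sign bit `1` whose support carries a fixed-point-free
involution preserving the radius-`r` windows of `x` defeats EVERY window strategy (with any input-global advice, which is
constant along `x` and hence absorbed into `F`). -/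
theorem not_rel_window_of_pairing {n : ℕ} (r : ℕ) (x v : Fin n → Bool) (σ : Fin n → Fin n)
    (hK : InKernel x v) (hsign : signBit x v = 1)
    (hσv : ∀ b, v b = true → v (σ b) = true) (hσw : ∀ b, v b = true → window r x (σ b) = window r x b)
    (hfix : ∀ b, v b = true → σ b ≠ b) (hinv : ∀ b, v b = true → σ (σ b) = b)
    (F : (Fin (2 * r + 1) → Bool) → Bool) : ¬ RingHLF.Rel x (fun i => F (window r x i)) := by
  intro h
  have h1 := h v hK
  rw [dot2_eq_zero_of_pairing v _ σ hσv (fun b hb => by simp only [hσw b hb]) hfix hinv, hsign] at h1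
  exact absurd h1 (by decide)

/-- `UniversalHard` from a certificate (odd class + pairing data). -/
theorem universalHard_of_pairing {n : ℕ} (r : ℕ) (x v : Fin n → Bool) (σ : Fin n → Fin n)
    (hodd : OddZeros x) (hK : InKernel x v) (hsign : signBit x v = 1)
    (hσv : ∀ b, v b = true → v (σ b) = true) (hσw : ∀ b, v b = true → window r x (σ b) = window r x b)
    (hfix : ∀ b, v b = true → σ b ≠ b) (hinv : ∀ b, v b = true → σ (σ b) = b) : UniversalHard r x :=
  ⟨hodd, fun F => not_rel_window_of_pairing r x v σ hK hsign hσv hσw hfix hinv F⟩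

/-! ## Cyclic index helpers -/

section Helpers

variable {n : ℕ}

/-- LightConeWindowHardA helper `nxt_val` (decomp-qadv land package; see the module docstring). -/
theorem nxt_val (b : Fin n) : ((nxt b : Fin n) : ℕ) = if (b : ℕ) + 1 < n then (b : ℕ) + 1 else 0 := by
  have hb := b.isLt
  simp only [nxt]
  split_ifs with h
  · exact Nat.mod_eq_of_lt h
  · have e : (b : ℕ) + 1 = n := by omega
    rw [e, Nat.mod_self]

/-- LightConeWindowHardA helper `prv_val` (decomp-qadv land package; see the module docstring). -/
theorem prv_val (b : Fin n) : ((prv b : Fin n) : ℕ) = if (b : ℕ) = 0 then n - 1 else (b : ℕ) - 1 := by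
  have hb := b.isLt
  simp only [prv]
  split_ifs with h
  · rw [h, Nat.zero_add]; exact Nat.mod_eq_of_lt (by omega)
  · have e : (b : ℕ) + n - 1 = ((b : ℕ) - 1) + n * 1 := by omega
    rw [e, Nat.add_mul_mod_self_left]; exact Nat.mod_eq_of_lt (by omega)

/-- The radius-1 window, with the cyclic index made explicit. -/

theorem xor3_eq_false_iff (a b c : Bool) : (xor (xor a b) c = false) ↔ (c = true ↔ a ≠ b) := by
  cases a <;> cases b <;> cases c <;> decide

end Helpers

/-! ## THE r-UNIFORM EVEN FAMILY (PROVED): ones `{0, 2r+1, 4r+4}`, every even `n ≥ 6r+6`, every radius `r`.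
Kernel support `{even b < 4r+4} ∪ [4r+4, n)`, `e = n − 4r − 4`, `w = 2`, sign bit 1, and an explicit window-preserving
fixed-point-free involution `σU` (12 linear branches).  Consequence: the EVEN half of `WindowSymHard3All` holds uniformly in
`r`; the odd half (`UniversalHardOddAll`, data: six ones with gaps `(1, 2r+1, 1, 2r+3, 1, rest)`, odd n ≥ 6r+9) is the residual. -/

section Uniform

variable {n : ℕ}

/-- The radius-`r` window with the cyclic index made explicit. -/
theorem window_apply (r : ℕ) (hn : r ≤ n) (x : Fin n → Bool) (i : Fin n) (d : Fin (2 * r + 1)) :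
    window r x i d = x ⟨if (i : ℕ) + d < r then n - r + i + d else if (i : ℕ) + d - r < n then (i : ℕ) + d - r
      else (i : ℕ) + d - r - n, by have := i.isLt; have := d.isLt; split_ifs <;> omega⟩ := by
  have hi := i.isLt
  have hd := d.isLt
  unfold window
  congr 1
  apply Fin.ext
  simp only
  split_ifs with h1 h2
  · have e : (i : ℕ) + n * r + n - r + d = (n - r + i + d) + n * r := by omega
    rw [e, Nat.add_mul_mod_self_left]; exact Nat.mod_eq_of_lt (by omega)
  · have e : (i : ℕ) + n * r + n - r + d = ((i : ℕ) + d - r) + n * r + n := by omega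
    rw [e, Nat.add_mod_right, Nat.add_mul_mod_self_left]; exact Nat.mod_eq_of_lt h2
  · have e : (i : ℕ) + n * r + n - r + d = ((i : ℕ) + d - r - n) + n * r + n + n := by omega
    rw [e, Nat.add_mod_right, Nat.add_mod_right, Nat.add_mul_mod_self_left]; exact Nat.mod_eq_of_lt (by omega)

/-- Uniform even family: ones at `0, 2r+1, 4r+4`. -/
def xU (r n : ℕ) : Fin n → Bool := fun j => decide ((j : ℕ) = 0 ∨ (j : ℕ) = 2 * r + 1 ∨ (j : ℕ) = 4 * r + 4)
/-- Its kernel support: even `b < 4r+4` and all `b ≥ 4r+4`. -/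
abbrev VU (r t : ℕ) : Prop := t % 2 = 0 ∨ 4 * r + 4 ≤ t
/-- LightConeWindowHardA helper `vU` (decomp-qadv land package; see the module docstring). -/
def vU (r n : ℕ) : Fin n → Bool := fun b => decide (VU r b)
/-- The pairing (12 pairwise-disjoint linear branches; see LIGHTCONE.md §4e). -/
def σUval (r n t : ℕ) : ℕ :=
  if t % 2 = 0 ∧ t ≤ r then t + (4 * r + 4)
  else if t % 2 = 0 ∧ 4 * r + 4 ≤ t ∧ t ≤ 5 * r + 4 then t - (4 * r + 4)
  else if t % 2 = 0 ∧ r + 1 ≤ t ∧ t ≤ 2 * r then n - (2 * r + 1 - t)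
  else if t % 2 = 1 ∧ n - r ≤ t then t + (2 * r + 1) - n
  else if t % 2 = 0 ∧ 2 * r + 2 ≤ t ∧ t ≤ 3 * r + 1 then t + (2 * r + 3)
  else if t % 2 = 1 ∧ 4 * r + 5 ≤ t ∧ t ≤ 5 * r + 4 then t - (2 * r + 3)
  else if t = 3 * r + 2 + r % 2 then 5 * r + 5
  else if t = 5 * r + 5 then 3 * r + 2 + r % 2
  else if t % 2 = 0 ∧ 3 * r + 4 ≤ t ∧ t ≤ 4 * r + 2 then n - (4 * r + 4 - t)
  else if t % 2 = 0 ∧ n - r ≤ t then t + (4 * r + 4) - n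
  else if 5 * r + 6 ≤ t ∧ t + r + 2 ≤ n ∧ (t + r) % 2 = 0 then t + 1
  else if 5 * r + 7 ≤ t ∧ t + r + 1 ≤ n ∧ (t + r) % 2 = 1 then t - 1
  else t

/-- LightConeWindowHardA helper `σU` (decomp-qadv land package; see the module docstring). -/
def σU (r k : ℕ) : Fin (2 * k) → Fin (2 * k) := fun b => ⟨min (σUval r (2 * k) b) (2 * k - 1), by have := b.isLt; omega⟩

/-- LightConeWindowHardA helper `VU_cases` (decomp-qadv land package; see the module docstring). -/
theorem VU_cases (r k t : ℕ) (hk : 3 * r + 3 ≤ k) (ht : t < 2 * k) (hV : VU r t) :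
    (t % 2 = 0 ∧ t ≤ r) ∨
    (t % 2 = 0 ∧ 4 * r + 4 ≤ t ∧ t ≤ 5 * r + 4) ∨
    (t % 2 = 0 ∧ r + 1 ≤ t ∧ t ≤ 2 * r) ∨
    (t % 2 = 1 ∧ 2 * k - r ≤ t) ∨
    (t % 2 = 0 ∧ 2 * r + 2 ≤ t ∧ t ≤ 3 * r + 1) ∨
    (t % 2 = 1 ∧ 4 * r + 5 ≤ t ∧ t ≤ 5 * r + 4) ∨
    (t = 3 * r + 2 + r % 2) ∨
    (t = 5 * r + 5) ∨
    (t % 2 = 0 ∧ 3 * r + 4 ≤ t ∧ t ≤ 4 * r + 2) ∨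
    (t % 2 = 0 ∧ 2 * k - r ≤ t) ∨
    (5 * r + 6 ≤ t ∧ t + r + 2 ≤ 2 * k ∧ (t + r) % 2 = 0) ∨
    (5 * r + 7 ≤ t ∧ t + r + 1 ≤ 2 * k ∧ (t + r) % 2 = 1) := by
  rcases hV with he | hge
  · by_cases h1 : t ≤ r
    · exact Or.inl ⟨he, h1⟩
    by_cases h2 : t ≤ 2 * r
    · exact Or.inr (Or.inr (Or.inl ⟨he, by omega, h2⟩))
    by_cases h3 : t ≤ 3 * r + 1
    · exact Or.inr (Or.inr (Or.inr (Or.inr (Or.inl ⟨he, by omega, h3⟩))))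
    by_cases h4 : t ≤ 3 * r + 3
    · exact Or.inr (Or.inr (Or.inr (Or.inr (Or.inr (Or.inr (Or.inl (by omega)))))))
    by_cases h5 : t ≤ 4 * r + 2
    · exact Or.inr (Or.inr (Or.inr (Or.inr (Or.inr (Or.inr (Or.inr (Or.inr (Or.inl ⟨he, by omega, h5⟩))))))))
    by_cases h6 : t ≤ 5 * r + 4
    · exact Or.inr (Or.inl ⟨he, by omega, h6⟩)
    by_cases h7 : t = 5 * r + 5
    · exact Or.inr (Or.inr (Or.inr (Or.inr (Or.inr (Or.inr (Or.inr (Or.inl h7)))))))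
    by_cases h8 : 2 * k - r ≤ t
    · exact Or.inr (Or.inr (Or.inr (Or.inr (Or.inr (Or.inr (Or.inr (Or.inr (Or.inr (Or.inl ⟨he, h8⟩)))))))))
    by_cases h9 : (t + r) % 2 = 0
    · exact Or.inr (Or.inr (Or.inr (Or.inr (Or.inr (Or.inr (Or.inr (Or.inr (Or.inr (Or.inr (Or.inl ⟨by omega, by omega, h9⟩))))))))))
    · exact Or.inr (Or.inr (Or.inr (Or.inr (Or.inr (Or.inr (Or.inr (Or.inr (Or.inr (Or.inr (Or.inr (⟨by omega, by omega, by omega⟩)))))))))))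
  · by_cases he : t % 2 = 0
    · by_cases h6 : t ≤ 5 * r + 4
      · exact Or.inr (Or.inl ⟨he, hge, h6⟩)
      by_cases h7 : t = 5 * r + 5
      · exact Or.inr (Or.inr (Or.inr (Or.inr (Or.inr (Or.inr (Or.inr (Or.inl h7)))))))
      by_cases h8 : 2 * k - r ≤ t
      · exact Or.inr (Or.inr (Or.inr (Or.inr (Or.inr (Or.inr (Or.inr (Or.inr (Or.inr (Or.inl ⟨he, h8⟩)))))))))
      by_cases h9 : (t + r) % 2 = 0
      · exact Or.inr (Or.inr (Or.inr (Or.inr (Or.inr (Or.inr (Or.inr (Or.inr (Or.inr (Or.inr (Or.inl ⟨by omega, by omega, h9⟩))))))))))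
      · exact Or.inr (Or.inr (Or.inr (Or.inr (Or.inr (Or.inr (Or.inr (Or.inr (Or.inr (Or.inr (Or.inr (⟨by omega, by omega, by omega⟩)))))))))))
    · by_cases h6 : t ≤ 5 * r + 4
      · exact Or.inr (Or.inr (Or.inr (Or.inr (Or.inr (Or.inl ⟨by omega, by omega, h6⟩)))))
      by_cases h7 : t = 5 * r + 5
      · exact Or.inr (Or.inr (Or.inr (Or.inr (Or.inr (Or.inr (Or.inr (Or.inl h7)))))))
      by_cases h8 : 2 * k - r ≤ t
      · exact Or.inr (Or.inr (Or.inr (Or.inl ⟨by omega, h8⟩)))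
      by_cases h9 : (t + r) % 2 = 0
      · exact Or.inr (Or.inr (Or.inr (Or.inr (Or.inr (Or.inr (Or.inr (Or.inr (Or.inr (Or.inr (Or.inl ⟨by omega, by omega, h9⟩))))))))))
      · exact Or.inr (Or.inr (Or.inr (Or.inr (Or.inr (Or.inr (Or.inr (Or.inr (Or.inr (Or.inr (Or.inr (⟨by omega, by omega, by omega⟩)))))))))))

/-- LightConeWindowHardA helper `inKernel_vU` (decomp-qadv land package; see the module docstring). -/
theorem inKernel_vU (r k : ℕ) (hk : 3 * r + 3 ≤ k) : InKernel (xU r (2 * k)) (vU r (2 * k)) := by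
  intro b
  rw [xor3_eq_false_iff]
  have hb := b.isLt
  simp only [vU, xU, Bool.and_eq_true, decide_eq_true_eq, ne_eq, decide_eq_decide, prv_val, nxt_val]
  split_ifs <;> omega

/-- LightConeWindowHardA helper `edgesIn_vU` (decomp-qadv land package; see the module docstring). -/
theorem edgesIn_vU (r k : ℕ) (hk : 3 * r + 3 ≤ k) : edgesIn (vU r (2 * k)) = 2 * k - (4 * r + 4) := by
  unfold edgesIn
  have h : (univ.filter fun b : Fin (2 * k) => vU r _ b = true ∧ vU r _ (nxt b) = true)
      = (Finset.Ico (4 * r + 4) (2 * k)).attachFin (fun t ht => (Finset.mem_Ico.1 ht).2) := by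
    ext b
    have hb := b.isLt
    simp only [mem_filter, mem_univ, true_and, mem_attachFin, vU, decide_eq_true_eq, nxt_val, Finset.mem_Ico]
    split_ifs <;> omega
  rw [h, card_attachFin, Nat.card_Ico]

/-- LightConeWindowHardA helper `wtAnd_vU` (decomp-qadv land package; see the module docstring). -/
theorem wtAnd_vU (r k : ℕ) (hk : 3 * r + 3 ≤ k) : wtAnd (xU r (2 * k)) (vU r (2 * k)) = 2 := by
  unfold wtAnd
  have h : (univ.filter fun b : Fin (2 * k) => xU r _ b = true ∧ vU r _ b = true)
      = ({0, 4 * r + 4} : Finset ℕ).attachFin (by intro t ht; simp only [mem_insert, mem_singleton] at ht; omega) := by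
    ext b
    have hb := b.isLt
    simp only [mem_filter, mem_univ, true_and, mem_attachFin, vU, xU, decide_eq_true_eq, mem_insert, mem_singleton]
    omega
  rw [h, card_attachFin, card_pair (by omega)]

/-- LightConeWindowHardA helper `signBit_vU` (decomp-qadv land package; see the module docstring). -/
theorem signBit_vU (r k : ℕ) (hk : 3 * r + 3 ≤ k) : signBit (xU r (2 * k)) (vU r (2 * k)) = 1 := by
  unfold signBit; rw [edgesIn_vU r k hk, wtAnd_vU r k hk]; omega

/-- LightConeWindowHardA helper `oddZeros_xU` (decomp-qadv land package; see the module docstring). -/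
theorem oddZeros_xU (r k : ℕ) (hk : 3 * r + 3 ≤ k) : OddZeros (xU r (2 * k)) := by
  unfold OddZeros
  have h : (univ.filter fun b : Fin (2 * k) => xU r _ b = false)
      = univ \ ({0, 2 * r + 1, 4 * r + 4} : Finset ℕ).attachFin (by
          intro t ht; simp only [mem_insert, mem_singleton] at ht; omega) := by
    ext b
    simp only [mem_filter, mem_univ, true_and, mem_sdiff, mem_attachFin, xU, decide_eq_false_iff_not, mem_insert,
      mem_singleton]
  rw [h, card_sdiff_of_subset (subset_univ _), card_attachFin, card_univ, Fintype.card_fin]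
  have h3 : ({0, 2 * r + 1, 4 * r + 4} : Finset ℕ).card = 3 := by
    rw [card_insert_of_notMem (by simp only [mem_insert, mem_singleton]; omega), card_pair (by omega)]
  rw [h3]; omega


end Uniform
end Summit.QuantumAdvantage.AdviceFreeQNC0.LightConeWindowHard
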